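import Literature.Computability.Complexity.BinarySubtraction
import Literature.Computability.Complexity.CircuitClasses
import Literature.Computability.Complexity.LengthCompare
import Literature.Computability.Complexity.PolyAdviceClosure
import Literature.Computability.Complexity.CircuitClassesUniformProofs
import HarnessLib

/-!
# Circuit evaluation in polynomial time and `P/poly = P/poly-advice` (Arora–Barak, Thm. 6.18)

This file DISCHARGES the named fact `Literature.Computability.Complexity.PPoly_eq_polyAdvice_P` (`CircuitClasses.lean`;
Arora–Barak 2009, Thm. 6.18: "`P/poly = ∪_{c,d} DTIME(n^c)/n^d`"): `PPoly_eq_polyAdvice_P_holds`.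

* `⊇`: `P ⊆ P/poly` (`P_subset_PPoly_holds`, `CircuitClassesUniformProofs.lean`, the tableau
  construction) and `(P/poly)/poly ⊆ P/poly` (`polyAdvice_subset_PPoly`,
  `PolyAdviceClosure.lean`, hardwiring the advice).
* `⊆` (`PPoly_subset_polyAdvice_P`, the substantial direction, Arora–Barak's "if `L ∈ P/poly` is
  decided by the family `{Cₙ}`, use the description of `Cₙ` as advice and the polynomial-time
  machine that evaluates a circuit on an input"): we give the circuit-evaluation machine as a
  structured stack program (`StackPrograms.Com`, compiled to `FP` by `Com.mem_FP`) together with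
  the encoding `desc C` of a `B₂`-circuit used as advice, and prove `evalFn ∈ FP`
  (`evalFn_mem_FP`, linear time `18|z| + 7`) and `evalFn ⟨x, desc C⟩ = [C(x)]`
  (`evalFn_boolPair_desc`).

## The machine and the encoding

The evaluator is a four-instruction value-stack machine (`CircEval.vmLoop`) reading 2-bit
opcodes from the program register: `11 = ROT` moves the top value to an auxiliary stack `T`,
`10 = BACK` moves it back, `01 = READ` copies the top value onto a selection stack `S`, and
`00 t₀ t₁ t₂ t₃ = TAB` pops `b₁, b₀` from `S` and pushes the table entry `t_{2b₀+b₁}`. The value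
stack holds, top to bottom, the values of the gates evaluated so far (newest first), the input
bits (last first) and a sentinel `0` (`CircEval.layV`); so the value of a wire lies at a depth the
compiler knows (`CircEval.depth`: input `i` at depth `j + (n-1-i)`, gate `m` at depth `j-1-m`
after `j` gates), and is read by `ROT^e READ BACK^e` (`CircEval.readCode`). A gate of arity
`≤ 2` is compiled to two reads and a `TAB` with its binary truth table (`CircEval.gateCode`,
`CircEval.table`); the circuit to the codes of its gates followed by a copy of the output wire to
the top (`CircEval.desc`), of length `≤ (|C|+1)(8(n+|C|)+10)` (`CircEval.length_desc_le`). The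
whole program (`CircEval.evalProg`) pushes the sentinel, parses the pair with the parser of
`BinarySubtraction.lean` (`BinSub.parse`), restores the program order, runs the machine
(functional semantics `CircEval.vmSpec`, cost `≤ 10|D| + 1`, `CircEval.runs_vmLoop`) and outputs
the top value. Correctness of the compiled code is `CircEval.vmSpec_desc` (gate by gate,
`CircEval.vmSpec_codeFrom`, against the fold `Circuit.wireVals`).

## Main statements

* `CircEval.evalFn_mem_FP`, `CircEval.evalFn_boolPair_desc`, `CircEval.EvalLang_mem_P`.
* `PPoly_subset_polyAdvice_P : PPoly ⊆ polyAdvice P`.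
* `PPoly_eq_polyAdvice_P_holds : PPoly_eq_polyAdvice_P` (discharge, D-0014).

## References

* S. Arora, B. Barak, *Computational Complexity: A Modern Approach*, CUP 2009, Def. 6.1,
  Rem. 6.4 (straight-line programs), Def. 6.5, Def. 6.16, Thm. 6.18 and its proof.
* R. M. Karp, R. J. Lipton, *Some connections between nonuniform and uniform complexity
  classes*, STOC 1980 (advice classes).
* T. Nipkow, G. Klein, *Concrete Semantics*, Springer 2014, Ch. 7–8 (the program semantics used
  by `StackPrograms.lean`).
-/

namespace Literature.Computability.Complexity

open BinSub Com

namespace CircEval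

/-! ### The value-stack machine

Registers (those of `BinSub.Rg`): `u` is the value stack `V` (top = head), `u2` the stack `T`
of dug-out values, `br` the stack `S` of read bits, `v2` the program `D`; `inp`, `v` serve the
parser, `out` receives the answer, `res` is unused. Instructions are the 2-bit opcodes
`11 = ROT` (move the top value to `T`), `10 = BACK` (move it back), `01 = READ` (copy the top
value onto `S`), `00 t₀ t₁ t₂ t₃ = TAB` (pop `b₁, b₀` from `S` and push the table entry
`t_{2 b₀ + b₁}` onto `V`). -/

/-- `ROT`: move the top of the value stack onto `T`. [folklore] -/
def rotC : Com Rg := pop .u (push .u2 true) (push .u2 false) skip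

/-- `BACK`: move the top of `T` back onto the value stack. [folklore] -/
def backC : Com Rg := pop .u2 (push .u true) (push .u false) skip

/-- `READ`: copy the top of the value stack onto the selection stack `S`. [folklore] -/
def readC : Com Rg := pop .u (push .u true ;; push .br true) (push .u false ;; push .br false) skip

/-- Consume one program bit; push it onto the value stack iff `p = i`. [folklore] -/
def pick (i p : ℕ) : Com Rg :=
  pop .v2 (if p = i then push .u true else skip) (if p = i then push .u false else skip) skip

/-- Consume `k` program bits at positions `p, p+1, …`, keeping the one at position `i`. [folklore] -/
def picks (i : ℕ) : ℕ → ℕ → Com Rg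
  | _, 0 => skip
  | p, k + 1 => pick i p ;; picks i (p + 1) k

/-- `TAB`: pop `b₁` then `b₀` from `S` (missing bits read `0`) and keep entry `2 b₀ + b₁` of the
next four program bits. [folklore] -/
def tabC : Com Rg :=
  pop .br (pop .br (picks 3 0 4) (picks 1 0 4) (picks 1 0 4))
    (pop .br (picks 2 0 4) (picks 0 0 4) (picks 0 0 4)) (picks 0 0 4)

/-- Loop body after a first opcode bit `1`: `11 = ROT`, `10 = BACK`. [folklore] -/
def bodyT : Com Rg := pop .v2 rotC backC skip

/-- Loop body after a first opcode bit `0`: `01 = READ`, `00 = TAB`. [folklore] -/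
def bodyF : Com Rg := pop .v2 readC tabC skip

/-- The machine: interpret the program register `v2` to exhaustion. [folklore] -/
def vmLoop : Com Rg := loop .v2 bodyT bodyF

/-! ### Functional semantics -/

/-- Keep the bit of `l` at position `i - p` (if `p ≤ i` and it exists) on top of `V`. [folklore] -/
def pickAt (i p : ℕ) (l V : List Bool) : List Bool :=
  match l[i - p]? with
  | some b => if p ≤ i then b :: V else V
  | none => V

/-- Selection from `S`: `(b₀, b₁, rest)`, missing bits read `0`. [folklore] -/
def sel : List Bool → Bool × Bool × List Bool
  | b1 :: b0 :: S => (b0, b1, S)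
  | [b1] => (false, b1, [])
  | [] => (false, false, [])

/-- The table index `2 b₀ + b₁`. [folklore] -/
def idxOf (b0 b1 : Bool) : ℕ := 2 * b0.toNat + b1.toNat

/-- One `TAB` step on `(D, V, S)`: the new value stack. [folklore] -/
def tabV (D V S : List Bool) : List Bool :=
  pickAt (idxOf (sel S).1 (sel S).2.1) 0 (D.take 4) V

/-- Functional semantics of the machine on `(D, V, T, S)`: the final `(V, T, S)`. [folklore] -/
def vmSpec : List Bool → List Bool → List Bool → List Bool → List Bool × List Bool × List Bool
  | [], V, T, S => (V, T, S)
  | [_], V, T, S => (V, T, S)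
  | true :: true :: D, [], T, S => vmSpec D [] T S
  | true :: true :: D, a :: V, T, S => vmSpec D V (a :: T) S
  | true :: false :: D, V, [], S => vmSpec D V [] S
  | true :: false :: D, V, a :: T, S => vmSpec D (a :: V) T S
  | false :: true :: D, [], T, S => vmSpec D [] T S
  | false :: true :: D, a :: V, T, S => vmSpec D (a :: V) T (a :: S)
  | false :: false :: t0 :: t1 :: t2 :: t3 :: D, V, T, S =>
      vmSpec D (tabV [t0, t1, t2, t3] V S) T (sel S).2.2
  | [false, false], V, T, S => (tabV [] V S, T, (sel S).2.2)
  | [false, false, t0], V, T, S => (tabV [t0] V S, T, (sel S).2.2)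
  | [false, false, t0, t1], V, T, S => (tabV [t0, t1] V S, T, (sel S).2.2)
  | [false, false, t0, t1, t2], V, T, S => (tabV [t0, t1, t2] V S, T, (sel S).2.2)

/-- The `TAB` equations in one: consume up to four table bits. [folklore] -/
theorem vmSpec_tab (D V T S : List Bool) :
    vmSpec (false :: false :: D) V T S = vmSpec (D.drop 4) (tabV D V S) T (sel S).2.2 := by
  rcases D with _ | ⟨t0, _ | ⟨t1, _ | ⟨t2, _ | ⟨t3, D⟩⟩⟩⟩ <;> simp [vmSpec, tabV]

/-! ### Step lemmas -/

section Steps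

variable (zi zv zr zo : List Bool)

/-- `ROT` on a nonempty value stack (cost `3`). [folklore] -/
theorem runs_rotC_cons (a : Bool) (V T D S : List Bool) :
    Runs rotC (mk zi (a :: V) zv T D S zr zo) (mk zi V zv (a :: T) D S zr zo) 3 := by
  unfold rotC
  cases a
  · exact Runs.pop_false' _ _ rfl (update_u ..) (Runs.push' (update_u2 ..))
  · exact Runs.pop_true' _ _ rfl (update_u ..) (Runs.push' (update_u2 ..))

/-- `ROT` on an empty value stack (cost `2`). [folklore] -/
theorem runs_rotC_nil (T D S : List Bool) :
    Runs rotC (mk zi [] zv T D S zr zo) (mk zi [] zv T D S zr zo) 2 := by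
  unfold rotC
  exact Runs.pop_nil _ _ rfl (Runs.skip _)

/-- `BACK` on a nonempty `T` (cost `3`). [folklore] -/
theorem runs_backC_cons (a : Bool) (V T D S : List Bool) :
    Runs backC (mk zi V zv (a :: T) D S zr zo) (mk zi (a :: V) zv T D S zr zo) 3 := by
  unfold backC
  cases a
  · exact Runs.pop_false' _ _ rfl (update_u2 ..) (Runs.push' (update_u ..))
  · exact Runs.pop_true' _ _ rfl (update_u2 ..) (Runs.push' (update_u ..))

/-- `BACK` on an empty `T` (cost `2`). [folklore] -/
theorem runs_backC_nil (V D S : List Bool) :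
    Runs backC (mk zi V zv [] D S zr zo) (mk zi V zv [] D S zr zo) 2 := by
  unfold backC
  exact Runs.pop_nil _ _ rfl (Runs.skip _)

/-- `READ` on a nonempty value stack (cost `4`). [folklore] -/
theorem runs_readC_cons (a : Bool) (V T D S : List Bool) :
    Runs readC (mk zi (a :: V) zv T D S zr zo) (mk zi (a :: V) zv T D (a :: S) zr zo) 4 := by
  unfold readC
  cases a
  · exact Runs.pop_false' _ _ rfl (update_u ..)
      (Runs.seq (Runs.push' (update_u ..)) (Runs.push' (update_br ..)))
  · exact Runs.pop_true' _ _ rfl (update_u ..)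
      (Runs.seq (Runs.push' (update_u ..)) (Runs.push' (update_br ..)))

/-- `READ` on an empty value stack (cost `2`). [folklore] -/
theorem runs_readC_nil (T D S : List Bool) :
    Runs readC (mk zi [] zv T D S zr zo) (mk zi [] zv T D S zr zo) 2 := by
  unfold readC
  exact Runs.pop_nil _ _ rfl (Runs.skip _)

/-- `pick i p` on a program bit (cost `≤ 3`). [folklore] -/
theorem runs_pick_cons (i p : ℕ) (b : Bool) (V T D S : List Bool) :
    Runs (pick i p) (mk zi V zv T (b :: D) S zr zo)
      (mk zi (if p = i then b :: V else V) zv T D S zr zo) 3 := by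
  unfold pick
  by_cases h : p = i
  · simp only [h, ↓reduceIte]
    cases b
    · exact Runs.pop_false' _ _ rfl (update_v2 ..) (Runs.push' (update_u ..))
    · exact Runs.pop_true' _ _ rfl (update_v2 ..) (Runs.push' (update_u ..))
  · simp only [h, ↓reduceIte]
    cases b
    · refine Runs.mono ?_ (show 0 + 2 ≤ 3 by norm_num)
      exact Runs.pop_false' _ _ rfl (update_v2 ..) (Runs.skip _)
    · refine Runs.mono ?_ (show 0 + 2 ≤ 3 by norm_num)
      exact Runs.pop_true' _ _ rfl (update_v2 ..) (Runs.skip _)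

/-- `pick i p` on an exhausted program (cost `2`). [folklore] -/
theorem runs_pick_nil (i p : ℕ) (V T S : List Bool) :
    Runs (pick i p) (mk zi V zv T [] S zr zo) (mk zi V zv T [] S zr zo) 2 := by
  unfold pick
  exact Runs.pop_nil _ _ rfl (Runs.skip _)

/-- The bookkeeping of successive picks. [folklore] -/
theorem pickAt_cons (i p : ℕ) (b : Bool) (l V : List Bool) :
    pickAt i p (b :: l) V = pickAt i (p + 1) l (if p = i then b :: V else V) := by
  unfold pickAt
  rcases Nat.lt_trichotomy i p with hlt | heq | hgt
  · have h1 : i - p = 0 := by omega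
    have h2 : i - (p + 1) = 0 := by omega
    rw [h1, h2, List.getElem?_cons_zero, if_neg (by omega : ¬ p = i)]
    cases l[0]? <;> simp [show ¬ p ≤ i by omega, show ¬ (p + 1 ≤ i) by omega]
  · subst heq
    rw [Nat.sub_self, List.getElem?_cons_zero, if_pos rfl, (by omega : i - (i + 1) = 0)]
    cases l[0]? <;> simp
  · have h1 : i - p = (i - (p + 1)) + 1 := by omega
    rw [h1, List.getElem?_cons_succ, if_neg (by omega : ¬ p = i)]
    cases l[i - (p + 1)]? <;> simp [show p ≤ i by omega, show p + 1 ≤ i by omega]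

/-- `pickAt` from an empty list does nothing. [folklore] -/
@[simp] theorem pickAt_nil (i p : ℕ) (V : List Bool) : pickAt i p [] V = V := by
  simp [pickAt]

/-- **Semantics of `picks`**: `k` program bits are consumed and the one at position `i` (counted
from `p`) is kept (cost `≤ 3k`). [folklore] -/
theorem runs_picks (i : ℕ) : ∀ (k p : ℕ) (V T D S : List Bool),
    Runs (picks i p k) (mk zi V zv T D S zr zo)
      (mk zi (pickAt i p (D.take k) V) zv T (D.drop k) S zr zo) (3 * k)
  | 0, p, V, T, D, S => by simpa [picks, pickAt] using Runs.skip (mk zi V zv T D S zr zo)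
  | k + 1, p, V, T, [], S => by
    have ih := runs_picks i k (p + 1) V T [] S
    simp only [List.take_nil, pickAt_nil, List.drop_nil] at ih ⊢
    refine Runs.mono ?_ (show 2 + 3 * k ≤ 3 * (k + 1) by omega)
    exact Runs.seq (runs_pick_nil zi zv zr zo i p V T S) ih
  | k + 1, p, V, T, b :: D, S => by
    have ih := runs_picks i k (p + 1) (if p = i then b :: V else V) T D S
    rw [List.take_succ_cons, List.drop_succ_cons, pickAt_cons]
    refine Runs.mono ?_ (show 3 + 3 * k ≤ 3 * (k + 1) by omega)
    exact Runs.seq (runs_pick_cons zi zv zr zo i p b V T D S) ih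

/-- **Semantics of `TAB`** (cost `≤ 16`). [folklore] -/
theorem runs_tabC (V T D S : List Bool) :
    Runs tabC (mk zi V zv T D S zr zo) (mk zi (tabV D V S) zv T (D.drop 4) (sel S).2.2 zr zo) 16 := by
  unfold tabC tabV
  rcases S with _ | ⟨b1, _ | ⟨b0, S⟩⟩
  · refine Runs.mono ?_ (show 3 * 4 + 2 ≤ 16 by norm_num)
    exact Runs.pop_nil _ _ rfl (runs_picks zi zv zr zo 0 4 0 V T D [])
  · refine Runs.mono ?_ (show 3 * 4 + 2 + 2 ≤ 16 by norm_num)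
    cases b1
    · exact Runs.pop_false' _ _ rfl (update_br ..)
        (Runs.pop_nil _ _ rfl (runs_picks zi zv zr zo 0 4 0 V T D []))
    · exact Runs.pop_true' _ _ rfl (update_br ..)
        (Runs.pop_nil _ _ rfl (runs_picks zi zv zr zo 1 4 0 V T D []))
  · refine Runs.mono ?_ (show 3 * 4 + 2 + 2 ≤ 16 by norm_num)
    cases b1 <;> cases b0
    · exact Runs.pop_false' _ _ rfl (update_br ..)
        (Runs.pop_false' _ _ rfl (update_br ..) (runs_picks zi zv zr zo 0 4 0 V T D S))
    · exact Runs.pop_false' _ _ rfl (update_br ..)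
        (Runs.pop_true' _ _ rfl (update_br ..) (runs_picks zi zv zr zo 2 4 0 V T D S))
    · exact Runs.pop_true' _ _ rfl (update_br ..)
        (Runs.pop_false' _ _ rfl (update_br ..) (runs_picks zi zv zr zo 1 4 0 V T D S))
    · exact Runs.pop_true' _ _ rfl (update_br ..)
        (Runs.pop_true' _ _ rfl (update_br ..) (runs_picks zi zv zr zo 3 4 0 V T D S))

/-- **Semantics of the machine**: the loop computes `vmSpec` at cost `≤ 10 |D| + 1`. [folklore] -/
theorem runs_vmLoop : ∀ (N : ℕ) (D V T S : List Bool), D.length ≤ N →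
    Runs vmLoop (mk zi V zv T D S zr zo)
      (mk zi (vmSpec D V T S).1 zv (vmSpec D V T S).2.1 [] (vmSpec D V T S).2.2 zr zo)
      (10 * D.length + 1) := by
  intro N
  induction N with
  | zero =>
    intro D V T S hD
    obtain rfl : D = [] := List.eq_nil_of_length_eq_zero (Nat.le_zero.1 hD)
    exact Runs.loop_nil _ _ rfl
  | succ N ih =>
    intro D V T S hD
    rcases D with _ | ⟨c0, _ | ⟨c1, D⟩⟩
    · exact Runs.loop_nil _ _ rfl
    · -- a single dangling bit
      have hrest : Runs vmLoop (mk zi V zv T [] S zr zo) (mk zi V zv T [] S zr zo) 1 := Runs.loop_nil _ _ rfl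
      refine Runs.mono ?_ (show (0 + 2) + 2 + 1 ≤ 10 * [c0].length + 1 by simp)
      cases c0
      · exact Runs.loop_false' (w := []) rfl (update_v2 ..) (Runs.pop_nil _ _ rfl (Runs.skip _)) hrest
      · exact Runs.loop_true' (w := []) rfl (update_v2 ..) (Runs.pop_nil _ _ rfl (Runs.skip _)) hrest
    · have hlen : D.length ≤ N := by simp at hD; omega
      cases c0 <;> cases c1
      · -- `00 = TAB`
        have ih' := ih (D.drop 4) (tabV D V S) T (sel S).2.2 (by simp; omega)
        rw [vmSpec_tab]
        refine Runs.mono ?_ (show (16 + 2) + 2 + (10 * (D.drop 4).length + 1) ≤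
          10 * (false :: false :: D).length + 1 by simp; omega)
        exact Runs.loop_false' rfl (update_v2 ..)
          (Runs.pop_false' _ _ rfl (update_v2 ..) (runs_tabC zi zv zr zo V T D S)) ih'
      · -- `01 = READ`
        rcases V with _ | ⟨a, V⟩
        · have ih' := ih D [] T S hlen
          rw [show vmSpec (false :: true :: D) [] T S = vmSpec D [] T S by simp [vmSpec]]
          refine Runs.mono ?_ (show (2 + 2) + 2 + (10 * D.length + 1) ≤
            10 * (false :: true :: D).length + 1 by simp; omega)
          exact Runs.loop_false' rfl (update_v2 ..)
            (Runs.pop_true' _ _ rfl (update_v2 ..) (runs_readC_nil zi zv zr zo T D S)) ih'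
        · have ih' := ih D (a :: V) T (a :: S) hlen
          rw [show vmSpec (false :: true :: D) (a :: V) T S = vmSpec D (a :: V) T (a :: S) by simp [vmSpec]]
          refine Runs.mono ?_ (show (4 + 2) + 2 + (10 * D.length + 1) ≤
            10 * (false :: true :: D).length + 1 by simp; omega)
          exact Runs.loop_false' rfl (update_v2 ..)
            (Runs.pop_true' _ _ rfl (update_v2 ..) (runs_readC_cons zi zv zr zo a V T D S)) ih'
      · -- `10 = BACK`
        rcases T with _ | ⟨a, T⟩
        · have ih' := ih D V [] S hlen
          rw [show vmSpec (true :: false :: D) V [] S = vmSpec D V [] S by simp [vmSpec]]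
          refine Runs.mono ?_ (show (2 + 2) + 2 + (10 * D.length + 1) ≤
            10 * (true :: false :: D).length + 1 by simp; omega)
          exact Runs.loop_true' rfl (update_v2 ..)
            (Runs.pop_false' _ _ rfl (update_v2 ..) (runs_backC_nil zi zv zr zo V D S)) ih'
        · have ih' := ih D (a :: V) T S hlen
          rw [show vmSpec (true :: false :: D) V (a :: T) S = vmSpec D (a :: V) T S by simp [vmSpec]]
          refine Runs.mono ?_ (show (3 + 2) + 2 + (10 * D.length + 1) ≤
            10 * (true :: false :: D).length + 1 by simp; omega)
          exact Runs.loop_true' rfl (update_v2 ..)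
            (Runs.pop_false' _ _ rfl (update_v2 ..) (runs_backC_cons zi zv zr zo a V T D S)) ih'
      · -- `11 = ROT`
        rcases V with _ | ⟨a, V⟩
        · have ih' := ih D [] T S hlen
          rw [show vmSpec (true :: true :: D) [] T S = vmSpec D [] T S by simp [vmSpec]]
          refine Runs.mono ?_ (show (2 + 2) + 2 + (10 * D.length + 1) ≤
            10 * (true :: true :: D).length + 1 by simp; omega)
          exact Runs.loop_true' rfl (update_v2 ..)
            (Runs.pop_true' _ _ rfl (update_v2 ..) (runs_rotC_nil zi zv zr zo T D S)) ih'
        · have ih' := ih D V (a :: T) S hlen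
          rw [show vmSpec (true :: true :: D) (a :: V) T S = vmSpec D V (a :: T) S by simp [vmSpec]]
          refine Runs.mono ?_ (show (3 + 2) + 2 + (10 * D.length + 1) ≤
            10 * (true :: true :: D).length + 1 by simp; omega)
          exact Runs.loop_true' rfl (update_v2 ..)
            (Runs.pop_true' _ _ rfl (update_v2 ..) (runs_rotC_cons zi zv zr zo a V T D S)) ih'

end Steps

/-! ### Programs for the machine -/

/-- `e` rotations. [folklore] -/
def rotCode : ℕ → List Bool
  | 0 => []
  | e + 1 => true :: true :: rotCode e

/-- `e` back-moves. [folklore] -/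
def backCode : ℕ → List Bool
  | 0 => []
  | e + 1 => true :: false :: backCode e

/-- Read the value at depth `e` of the value stack onto `S`: rotate `e` times, read, move back. [folklore] -/
def readCode (e : ℕ) : List Bool :=
  rotCode e ++ false :: true :: backCode e

/-- A table instruction with its four entries. [folklore] -/
def tabCode (t0 t1 t2 t3 : Bool) : List Bool :=
  [false, false, t0, t1, t2, t3]

/-- Length of `rotCode`. [folklore] -/
@[simp] theorem length_rotCode (e : ℕ) : (rotCode e).length = 2 * e := by
  induction e with
  | zero => rfl
  | succ e ih => simp [rotCode, ih]; ring

/-- Length of `backCode`. [folklore] -/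
@[simp] theorem length_backCode (e : ℕ) : (backCode e).length = 2 * e := by
  induction e with
  | zero => rfl
  | succ e ih => simp [backCode, ih]; ring

/-- Length of `readCode`. [folklore] -/
@[simp] theorem length_readCode (e : ℕ) : (readCode e).length = 4 * e + 2 := by
  simp [readCode]; ring

/-- Length of `tabCode`. [folklore] -/
@[simp] theorem length_tabCode (t0 t1 t2 t3 : Bool) : (tabCode t0 t1 t2 t3).length = 6 := rfl

/-- **Rotations dig out `e` values.** [folklore] -/
theorem vmSpec_rotCode : ∀ (e : ℕ) (D V T S : List Bool), e ≤ V.length →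
    vmSpec (rotCode e ++ D) V T S = vmSpec D (V.drop e) ((V.take e).reverse ++ T) S
  | 0, D, V, T, S, _ => by simp [rotCode]
  | e + 1, D, [], T, S, h => by simp at h
  | e + 1, D, a :: V, T, S, h => by
    rw [rotCode, List.cons_append, List.cons_append,
      show vmSpec (true :: true :: (rotCode e ++ D)) (a :: V) T S = vmSpec (rotCode e ++ D) V (a :: T) S by
        simp [vmSpec],
      vmSpec_rotCode e D V (a :: T) S (by simpa using h)]
    simp

/-- **Back-moves restore `e` values.** [folklore] -/
theorem vmSpec_backCode : ∀ (e : ℕ) (D V T S : List Bool), e ≤ T.length →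
    vmSpec (backCode e ++ D) V T S = vmSpec D ((T.take e).reverse ++ V) (T.drop e) S
  | 0, D, V, T, S, _ => by simp [backCode]
  | e + 1, D, V, [], S, h => by simp at h
  | e + 1, D, V, a :: T, S, h => by
    rw [backCode, List.cons_append, List.cons_append,
      show vmSpec (true :: false :: (backCode e ++ D)) V (a :: T) S = vmSpec (backCode e ++ D) (a :: V) T S by
        simp [vmSpec],
      vmSpec_backCode e D (a :: V) T S (by simpa using h)]
    simp

/-- **Reading at depth `e`**: the value `V[e]` is pushed onto `S`, the stacks are unchanged. [folklore] -/
theorem vmSpec_readCode (e : ℕ) (D V T S : List Bool) (h : e < V.length) :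
    vmSpec (readCode e ++ D) V T S = vmSpec D V T (V.getD e false :: S) := by
  rw [readCode, List.append_assoc, vmSpec_rotCode e _ V T S h.le, List.cons_append, List.cons_append,
    List.drop_eq_getElem_cons h,
    show vmSpec (false :: true :: (backCode e ++ D)) (V[e] :: V.drop (e + 1)) ((V.take e).reverse ++ T) S =
      vmSpec (backCode e ++ D) (V[e] :: V.drop (e + 1)) ((V.take e).reverse ++ T) (V[e] :: S) by simp [vmSpec],
    vmSpec_backCode e D _ _ _ (by simp; omega)]
  have hlen : (V.take e).reverse.length = e := by simp; omega
  rw [List.take_append_of_le_length hlen.ge, List.drop_append_of_le_length hlen.ge,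
    List.take_of_length_le hlen.le, List.drop_of_length_le hlen.le, List.reverse_reverse, List.nil_append,
    ← List.drop_eq_getElem_cons h, List.take_append_drop, List.getD_eq_getElem _ _ h]

/-- The table entry selected by `(b₀, b₁)`. [folklore] -/
def tabSel (t0 t1 t2 t3 : Bool) : Bool → Bool → Bool
  | false, false => t0
  | false, true => t1
  | true, false => t2
  | true, true => t3

/-- **The table instruction** pops the two read bits and pushes the selected entry. [folklore] -/
theorem vmSpec_tabCode (t0 t1 t2 t3 b0 b1 : Bool) (D V T S : List Bool) :
    vmSpec (tabCode t0 t1 t2 t3 ++ D) V T (b1 :: b0 :: S) = vmSpec D (tabSel t0 t1 t2 t3 b0 b1 :: V) T S := by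
  have h : tabV [t0, t1, t2, t3] V (b1 :: b0 :: S) = tabSel t0 t1 t2 t3 b0 b1 :: V := by
    cases b0 <;> cases b1 <;> rfl
  simp only [tabCode, List.cons_append, List.nil_append, vmSpec, h, sel]

/-- **A compiled gate**: read two depths, then apply a table; the selected entry of the values read
is pushed. [folklore] -/
theorem vmSpec_gate (e0 e1 : ℕ) (t0 t1 t2 t3 : Bool) (D V T : List Bool) (h0 : e0 < V.length)
    (h1 : e1 < V.length) :
    vmSpec (readCode e0 ++ readCode e1 ++ tabCode t0 t1 t2 t3 ++ D) V T [] =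
      vmSpec D (tabSel t0 t1 t2 t3 (V.getD e0 false) (V.getD e1 false) :: V) T [] := by
  rw [List.append_assoc, List.append_assoc, vmSpec_readCode e0 _ V T [] h0, vmSpec_readCode e1 _ V T _ h1,
    vmSpec_tabCode]

/-! ### Compiling a circuit -/

section Compile

variable {n : ℕ}

/-- Depth, from the top of the value stack after `j` gates, of the value of a wire: input `i`
sits at depth `j + (n - 1 - i)`, gate `m` at depth `j - 1 - m`. [folklore] -/
def depth (n j : ℕ) : Fin n ⊕ ℕ → ℕ
  | .inl i => j + (n - 1 - i)
  | .inr m => j - 1 - m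

/-- Depth of argument `a` of a gate (depth `0` for a missing argument). [folklore] -/
def argDepth (j : ℕ) (g : Gate (Fin n)) (a : ℕ) : ℕ :=
  if h : a < g.arity then depth n j (g.args ⟨a, h⟩) else 0

/-- The binary truth table of a gate of arity `≤ 2`. [folklore] -/
def table (g : Gate (Fin n)) (b0 b1 : Bool) : Bool :=
  g.op fun a => if a.val = 0 then b0 else b1

/-- The code of gate number `j`. [folklore] -/
def gateCode (j : ℕ) (g : Gate (Fin n)) : List Bool :=
  readCode (argDepth j g 0) ++ readCode (argDepth j g 1) ++
    tabCode (table g false false) (table g false true) (table g true false) (table g true true)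

/-- The code of a list of gates starting at gate number `j`. [folklore] -/
def codeFrom : ℕ → List (Gate (Fin n)) → List Bool
  | _, [] => []
  | j, g :: gs => gateCode j g ++ codeFrom (j + 1) gs

/-- The code bringing the value of the output wire to the top (table `(b₀, b₁) ↦ b₀`). [folklore] -/
def outCode (n j : ℕ) (w : Fin n ⊕ ℕ) : List Bool :=
  readCode (depth n j w) ++ readCode 0 ++ tabCode false false true true

/-- **The description of a circuit** used as advice: the codes of its gates followed by the
output code. [cite: AroraBarak2009, Thm. 6.18 (proof)] -/
def desc (C : Circuit (Fin n)) : List Bool :=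
  codeFrom 0 C.gates ++ outCode n C.size C.output

/-! #### Values -/

/-- The value of a wire given the input and the values of the earlier gates. [cite: AroraBarak2009, Rem. 6.4] -/
def wval (x : Fin n → Bool) (vals : List Bool) : Fin n ⊕ ℕ → Bool
  | .inl i => x i
  | .inr m => vals.getD m false

/-- The value of a gate given the input and the values of the earlier gates. [cite: AroraBarak2009, Rem. 6.4] -/
def gateVal (x : Fin n → Bool) (vals : List Bool) (g : Gate (Fin n)) : Bool :=
  g.op fun a => wval x vals (g.args a)

/-- The values of a list of gates evaluated after the values `vals`. [cite: AroraBarak2009, Rem. 6.4] -/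
def valsFrom (x : Fin n → Bool) (vals : List Bool) (gs : List (Gate (Fin n))) : List Bool :=
  gs.foldl (fun vs g => vs ++ [gateVal x vs g]) vals

/-- `valsFrom` on a cons. [folklore] -/
theorem valsFrom_cons (x : Fin n → Bool) (vals : List Bool) (g : Gate (Fin n)) (gs : List (Gate (Fin n))) :
    valsFrom x vals (g :: gs) = valsFrom x (vals ++ [gateVal x vals g]) gs := rfl

/-- Length of `valsFrom`. [folklore] -/
theorem length_valsFrom (x : Fin n → Bool) : ∀ (vals : List Bool) (gs : List (Gate (Fin n))),
    (valsFrom x vals gs).length = vals.length + gs.length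
  | vals, [] => by simp [valsFrom]
  | vals, g :: gs => by rw [valsFrom_cons, length_valsFrom]; simp; omega

/-- The circuit's wire values are `valsFrom x []`. [cite: AroraBarak2009, Rem. 6.4] -/
theorem wireVals_eq_valsFrom (C : Circuit (Fin n)) (x : Fin n → Bool) :
    C.wireVals x = valsFrom x [] C.gates := by
  unfold Circuit.wireVals valsFrom
  congr 1
  funext vs g
  congr 2
  unfold gateVal
  congr 1
  funext a
  cases g.args a <;> rfl

/-- The circuit's output is the value of the output wire. [cite: AroraBarak2009, Def. 6.1] -/
theorem eval_eq_wval (C : Circuit (Fin n)) (x : Fin n → Bool) :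
    C.eval x = wval x (valsFrom x [] C.gates) C.output := by
  rw [← wireVals_eq_valsFrom]
  unfold Circuit.eval
  cases C.output <;> rfl

/-! #### The value-stack layout -/

/-- The value stack after the gates with values `vals`: the values, newest on top, above the
input bits `xs` (last input on top) and a bottom sentinel `0`. [folklore] -/
def layV (vals xs : List Bool) : List Bool :=
  vals.reverse ++ (xs.reverse ++ [false])

/-- Length of the layout. [folklore] -/
@[simp] theorem length_layV (vals xs : List Bool) : (layV vals xs).length = vals.length + xs.length + 1 := by
  simp [layV]; omega

/-- Pushing a new value. [folklore] -/
theorem layV_append_singleton (vals xs : List Bool) (v : Bool) :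
    layV (vals ++ [v]) xs = v :: layV vals xs := by
  simp [layV]

/-- **Reading a wire off the layout**: at depth `depth n |vals| w` lies the value of the wire `w`
(inputs `xs = ofFn x`; back-references below `|vals|`). [folklore] -/
theorem getD_layV_depth (x : Fin n → Bool) (vals : List Bool) (w : Fin n ⊕ ℕ)
    (hw : ∀ m, w = .inr m → m < vals.length) :
    (layV vals (List.ofFn x)).getD (depth n vals.length w) false = wval x vals w := by
  rw [List.getD_eq_getElem?_getD, layV]
  cases w with
  | inl i =>
    have hi := i.isLt
    rw [depth, wval, List.getElem?_append_right (by simp), List.length_reverse, Nat.add_sub_cancel_left,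
      List.getElem?_append_left (by simp; omega),
      List.getElem?_reverse' (j := i.val) (by simp; omega), List.getElem?_ofFn]
    simp [hi]
  | inr m =>
    have hm := hw m rfl
    rw [depth, wval, List.getElem?_append_left (by simp; omega),
      List.getElem?_reverse' (j := m) (by omega), List.getD_eq_getElem?_getD]

/-- Depths are within the layout. [folklore] -/
theorem depth_lt_length_layV (vals xs : List Bool) (hxs : xs.length = n) (w : Fin n ⊕ ℕ) :
    depth n vals.length w < (layV vals xs).length := by
  cases w with
  | inl i => have := i.isLt; simp [depth]; omega
  | inr m => simp [depth]; omega

/-- Argument depths are within the layout. [folklore] -/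
theorem argDepth_lt_length_layV (vals xs : List Bool) (hxs : xs.length = n) (g : Gate (Fin n)) (a : ℕ) :
    argDepth vals.length g a < (layV vals xs).length := by
  unfold argDepth
  split
  · exact depth_lt_length_layV vals xs hxs _
  · simp

/-- **The table of a gate of arity `≤ 2` applied to the values read is the gate's value.** [folklore] -/
theorem table_eq_gateVal (x : Fin n → Bool) (vals : List Bool) (g : Gate (Fin n)) (hg : g.arity ≤ 2)
    (hwf : ∀ (a : Fin g.arity) (m : ℕ), g.args a = .inr m → m < vals.length) :
    table g ((layV vals (List.ofFn x)).getD (argDepth vals.length g 0) false)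
        ((layV vals (List.ofFn x)).getD (argDepth vals.length g 1) false) = gateVal x vals g := by
  unfold table gateVal
  congr 1
  funext a
  rcases a with ⟨_ | _ | k, ha⟩
  · simp only [↓reduceIte, argDepth, dif_pos ha]
    exact getD_layV_depth x vals _ (hwf _)
  · simp only [Nat.succ_ne_zero, ↓reduceIte, argDepth, dif_pos ha]
    exact getD_layV_depth x vals _ (hwf _)
  · omega

/-- **Simulation of one gate.** [cite: AroraBarak2009, Thm. 6.18 (proof)] -/
theorem vmSpec_gateCode (x : Fin n → Bool) (vals : List Bool) (g : Gate (Fin n)) (hg : g.arity ≤ 2)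
    (hwf : ∀ (a : Fin g.arity) (m : ℕ), g.args a = .inr m → m < vals.length) (D T : List Bool) :
    vmSpec (gateCode vals.length g ++ D) (layV vals (List.ofFn x)) T [] =
      vmSpec D (layV (vals ++ [gateVal x vals g]) (List.ofFn x)) T [] := by
  rw [gateCode, vmSpec_gate _ _ _ _ _ _ _ _ _ (argDepth_lt_length_layV vals _ (List.length_ofFn) g 0)
    (argDepth_lt_length_layV vals _ (List.length_ofFn) g 1), layV_append_singleton]
  congr 2
  have h := table_eq_gateVal x vals g hg hwf
  revert h
  cases (layV vals (List.ofFn x)).getD (argDepth vals.length g 0) false <;>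
    cases (layV vals (List.ofFn x)).getD (argDepth vals.length g 1) false <;> exact id

/-- **Simulation of a list of gates.** [cite: AroraBarak2009, Thm. 6.18 (proof)] -/
theorem vmSpec_codeFrom (x : Fin n → Bool) : ∀ (todo : List (Gate (Fin n))) (vals : List Bool),
    (∀ g ∈ todo, g.arity ≤ 2) →
    (∀ (k : ℕ) (hk : k < todo.length) (a : Fin (todo[k]).arity) (m : ℕ),
      (todo[k]).args a = .inr m → m < vals.length + k) →
    ∀ (D T : List Bool), vmSpec (codeFrom vals.length todo ++ D) (layV vals (List.ofFn x)) T [] =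
      vmSpec D (layV (valsFrom x vals todo) (List.ofFn x)) T []
  | [], vals, _, _, D, T => by simp [codeFrom, valsFrom]
  | g :: todo, vals, har, hwf, D, T => by
    rw [codeFrom, List.append_assoc,
      vmSpec_gateCode x vals g (har g (List.mem_cons_self ..)) (fun a m h => by
        have := hwf 0 (Nat.zero_lt_succ _) a m h; omega) _ T,
      valsFrom_cons]
    have hlen : (vals ++ [gateVal x vals g]).length = vals.length + 1 := by simp
    rw [← hlen]
    refine vmSpec_codeFrom x todo _ (fun g' hg' => har g' (List.mem_cons_of_mem _ hg')) ?_ D T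
    intro k hk a m h
    have := hwf (k + 1) (by simpa using hk) a m h
    rw [hlen]; omega

/-- **Simulation of the output code**: the value of the output wire lands on top. [folklore] -/
theorem vmSpec_outCode (x : Fin n → Bool) (vals : List Bool) (w : Fin n ⊕ ℕ)
    (hw : ∀ m, w = .inr m → m < vals.length) (T : List Bool) :
    vmSpec (outCode n vals.length w) (layV vals (List.ofFn x)) T [] =
      (wval x vals w :: layV vals (List.ofFn x), T, []) := by
  rw [outCode, ← List.append_nil (readCode (depth n vals.length w) ++ readCode 0 ++ tabCode false false true true),
    vmSpec_gate _ _ _ _ _ _ _ _ _ (depth_lt_length_layV vals _ (List.length_ofFn) w) (by simp),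
    getD_layV_depth x vals w hw]
  have h : ∀ b c : Bool, tabSel false false true true b c = b := by decide
  rw [h]
  rfl

/-- **Correctness of the compiled description**: running `desc C` on the laid-out input leaves
`C.eval x` on top of the value stack. [cite: AroraBarak2009, Thm. 6.18 (proof)] -/
theorem vmSpec_desc (C : Circuit (Fin n)) (hC : ∀ g ∈ C.gates, g.arity ≤ 2) (x : Fin n → Bool) :
    (vmSpec (desc C) (layV [] (List.ofFn x)) [] []).1.headD false = C.eval x := by
  have h1 := vmSpec_codeFrom x C.gates [] hC (fun k hk a m h => by
    have := C.wf k hk a m h; simpa using this) (outCode n C.size C.output) []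
  rw [List.length_nil] at h1
  have hlen : (valsFrom x [] C.gates).length = C.size := by
    rw [length_valsFrom]; simp [Circuit.size]
  have h2 := vmSpec_outCode x (valsFrom x [] C.gates) C.output (fun m hm => by
    rw [hlen]; exact C.wf_output m hm) []
  rw [hlen] at h2
  rw [desc, h1, h2, eval_eq_wval]
  rfl

/-! #### Length of the description -/

/-- Depths are at most `j + n`. [folklore] -/
theorem depth_le (j : ℕ) (w : Fin n ⊕ ℕ) : depth n j w ≤ j + n := by
  cases w with
  | inl i => have := i.isLt; simp [depth]; omega
  | inr m => simp [depth]; omega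

/-- The code of a gate numbered `j` has length `≤ 8 (j + n) + 10`. [folklore] -/
theorem length_gateCode_le (j : ℕ) (g : Gate (Fin n)) : (gateCode j g).length ≤ 8 * (j + n) + 10 := by
  have h : ∀ a, argDepth j g a ≤ j + n := fun a => by
    unfold argDepth; split
    · exact depth_le j _
    · exact Nat.zero_le _
  have h0 := h 0
  have h1 := h 1
  simp only [gateCode, List.length_append, length_readCode, length_tabCode]
  omega

/-- The code of `gs` from gate number `j` has length `≤ |gs| (8 (j + |gs| + n) + 10)`. [folklore] -/
theorem length_codeFrom_le : ∀ (j : ℕ) (gs : List (Gate (Fin n))),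
    (codeFrom j gs).length ≤ gs.length * (8 * (j + gs.length + n) + 10)
  | j, [] => by simp [codeFrom]
  | j, g :: gs => by
    rw [codeFrom, List.length_append]
    have h1 := length_gateCode_le j g
    have h2 := length_codeFrom_le (j + 1) gs
    have h3 : gs.length * (8 * (j + 1 + gs.length + n) + 10) ≤ gs.length * (8 * (j + (gs.length + 1) + n) + 10) :=
      Nat.mul_le_mul_left _ (by omega)
    simp only [List.length_cons]
    nlinarith

/-- **The description has polynomial length**: `|desc C| ≤ (|C| + 1) (8 (n + |C|) + 10)`. [folklore] -/
theorem length_desc_le (C : Circuit (Fin n)) : (desc C).length ≤ (C.size + 1) * (8 * (n + C.size) + 10) := by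
  rw [desc, List.length_append]
  have h1 := length_codeFrom_le 0 C.gates
  have h2 : (outCode n C.size C.output).length ≤ 8 * (C.size + n) + 10 := by
    have := depth_le C.size C.output
    simp only [outCode, List.length_append, length_readCode, length_tabCode]
    omega
  simp only [zero_add, Circuit.size] at h1 h2 ⊢
  nlinarith

end Compile

/-! ### The evaluator program -/

/-- Output the top of the value stack (`0` if empty). [folklore] -/
def outC : Com Rg := pop .u (push .out true) (push .out false) (push .out false)

/-- **The circuit evaluator**: sentinel, parse `⟨x, d⟩` (`u = reverse x ++ [0]`, `v = reverse d`),
restore the program (`v2 = d`), run the machine, output the top value. [cite: AroraBarak2009, Thm. 6.18 (proof)] -/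
def evalProg : Com Rg := push .u false ;; parse ;; move .v .v2 ;; vmLoop ;; outC

/-- The function computed by the evaluator. [folklore] -/
def evalFn (z : List Bool) : List Bool :=
  [(vmSpec (parseSpec z [false] []).2.reverse (parseSpec z [false] []).1 [] []).1.headD false]

/-- Semantics of `outC` (cost `3`). [folklore] -/
theorem runs_outC (V T S : List Bool) :
    Runs outC (mk [] V [] T [] S [] []) (mk [] V.tail [] T [] S [] [V.headD false]) 3 := by
  unfold outC
  rcases V with _ | ⟨b, V⟩
  · exact Runs.pop_nil _ _ rfl (Runs.push' (update_out ..))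
  · cases b
    · exact Runs.pop_false' _ _ rfl (update_u ..) (Runs.push' (update_out ..))
    · exact Runs.pop_true' _ _ rfl (update_u ..) (Runs.push' (update_out ..))

/-- **The evaluator runs in linear time** (`18 |z| + 7` steps) and outputs `evalFn z`. [folklore] -/
theorem runs_evalProg (z : List Bool) :
    ∃ R' : Regs Rg, Runs evalProg (Regs.init Rg.inp z) R' (18 * z.length + 7) ∧ R' .out = evalFn z := by
  rw [init_eq]
  set U := (parseSpec z [false] []).1 with hU
  set W := (parseSpec z [false] []).2 with hW
  obtain ⟨hUl, hWl⟩ := length_parseSpec_le z [false] []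
  rw [← hW, List.length_nil, add_zero] at hWl
  have h0 : Runs (push .u false) (mk z [] [] [] [] [] [] []) (mk z [false] [] [] [] [] [] []) 1 :=
    Runs.push' (update_u ..)
  have h1 : Runs parse (mk z [false] [] [] [] [] [] []) (mk [] U W [] [] [] [] []) (5 * z.length + 1) := by
    have := runs_parse z [false] [] [] [] [] [] []
    rwa [← hU, ← hW] at this
  have h2 : Runs (move .v .v2) (mk [] U W [] [] [] [] []) (mk [] U [] [] W.reverse [] [] []) (3 * W.length + 1) := by
    have := runs_move (k := Rg.v) (k' := Rg.v2) (by decide) W (mk [] U W [] [] [] [] []) rfl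
    simpa using this
  have h3 := runs_vmLoop [] [] [] [] W.reverse.length W.reverse U [] [] le_rfl
  have h4 := runs_outC (vmSpec W.reverse U [] []).1 (vmSpec W.reverse U [] []).2.1 (vmSpec W.reverse U [] []).2.2
  refine ⟨_, (Runs.seq h0 (Runs.seq h1 (Runs.seq h2 (Runs.seq h3 h4)))).mono ?_, rfl⟩
  rw [List.length_reverse]
  omega

/-- **Circuit evaluation is polynomial time**: `evalFn ∈ FP`. [cite: AroraBarak2009, Thm. 6.18 (proof: "CKT-EVAL ∈ P")] -/
theorem evalFn_mem_FP : evalFn ∈ FP :=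
  Com.mem_FP evalProg Rg.inp Rg.out (18 * Polynomial.X + 7) evalFn fun z => by
    obtain ⟨R', hR, hout⟩ := runs_evalProg z
    exact ⟨R', Or.inl (by simpa using hR), hout⟩

/-- The evaluator always answers one bit. [folklore] -/
theorem evalFn_eq_or (z : List Bool) : evalFn z = [true] ∨ evalFn z = [false] := by
  unfold evalFn
  cases (vmSpec (parseSpec z [false] []).2.reverse (parseSpec z [false] []).1 [] []).1.headD false <;> simp

/-- **The evaluator on `⟨x, desc C⟩` computes `C(x)`** for every `B₂`-circuit `C` on `|x|` inputs. [cite: AroraBarak2009, Thm. 6.18 (proof)] -/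
theorem evalFn_boolPair_desc (w : List Bool) (C : Circuit (Fin w.length)) (hC : ∀ g ∈ C.gates, g.arity ≤ 2) :
    evalFn (boolPair w (desc C)) = [C.eval w.get] := by
  rw [evalFn, parseSpec_boolPair, List.append_nil, List.reverse_reverse, ← vmSpec_desc C hC w.get]
  congr 4
  rw [layV, List.reverse_nil, List.nil_append, List.ofFn_get]

/-! ### `P/poly ⊆ P/poly-advice` and Arora–Barak's Theorem 6.18 -/

/-- The circuit-evaluation language `{⟨x, d⟩ | the evaluator accepts}`. [cite: AroraBarak2009, Thm. 6.18 (proof)] -/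
def EvalLang : Language Bool :=
  {z | evalFn z = [true]}

/-- **`EvalLang ∈ P`.** [cite: AroraBarak2009, Thm. 6.18 (proof)] -/
theorem EvalLang_mem_P : EvalLang ∈ Classes.P :=
  mem_P_of_mem_FP evalFn_mem_FP _ fun z => ⟨fun h => h, fun h => (evalFn_eq_or z).resolve_left h⟩

end CircEval

open CircEval

/-- **`P/poly ⊆ P/poly-advice`** (the substantial inclusion of Arora–Barak 2009, Thm. 6.18): a
polynomial-size circuit family is evaluated in polynomial time given the description of the
`n`-th circuit as advice. [cite: AroraBarak2009, Thm. 6.18] -/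
theorem PPoly_subset_polyAdvice_P : PPoly ⊆ polyAdvice Classes.P := by
  intro L hL
  simp only [PPoly, Set.mem_iUnion] at hL
  obtain ⟨p, C, hC, hdec⟩ := hL
  have har : ∀ n, ∀ g ∈ (C n).gates, g.arity ≤ 2 := fun n g hg => (hC n).1 g hg
  refine ⟨EvalLang, EvalLang_mem_P, fun n => desc (C n), (p + 1) * (8 * (Polynomial.X + p) + 10),
    fun n => ?_, fun x => ?_⟩
  · refine (length_desc_le (C n)).trans ?_
    have hs : (C n).size ≤ p.eval n := (hC n).2
    simp only [Polynomial.eval_mul, Polynomial.eval_add, Polynomial.eval_one, Polynomial.eval_X,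
      Polynomial.eval_ofNat]
    exact Nat.mul_le_mul (by omega) (by omega)
  · change x ∈ L ↔ evalFn (boolPair x (desc (C x.length))) = [true]
    rw [evalFn_boolPair_desc x (C x.length) (har x.length), hdec x, List.cons.injEq]
    simp only [and_true]
    exact Set.mem_iff_boolIndicator L x

/-- **Discharge of the named fact `PPoly_eq_polyAdvice_P`** (Arora–Barak 2009, Thm. 6.18:
`P/poly = P/poly-advice`): `⊆` is `PPoly_subset_polyAdvice_P`; `⊇` is `P ⊆ P/poly`
(`P_subset_PPoly_holds`, the tableau construction) and the closure `(P/poly)/poly ⊆ P/poly`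
(`polyAdvice_subset_PPoly`, hardwired advice). [cite: AroraBarak2009, Thm. 6.18] -/
theorem PPoly_eq_polyAdvice_P_holds : PPoly_eq_polyAdvice_P :=
  Set.Subset.antisymm PPoly_subset_polyAdvice_P (polyAdvice_subset_PPoly P_subset_PPoly_holds)

end Literature.Computability.Complexity
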